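import Summits.AtomisticToContinuum.Crystallization.Theorems.FrustratedLawDichotomyStrainedPatchHomLeafTableFold

/-!
# PARAM-FORM ("entry-native") fcc table leaf `leafCheckP`: radius-generic fold + per-label ENTRY radius + pulled-back gradient penalty

decomp-a2c hand-1 g23 (crux `AperiodicFrustratedLawGap`, stmt-AtomisticToContinuum-27623; critic row 882).  DEFINITIONS ONLY (computable; no
instances, no notation, no `#eval`).  The v2/v3 leaf checker `leafCheck` works on a GRAM box: per label `v = b` the range radius is
`r = Σⱼ |mⱼ| ŵⱼ` over the six Gram classes and the first-order penalty is class-wise, `Σⱼ (|gⱼ| + E·Aⱼ) ŵⱼ`.  When the Gram box is the interval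
image of an ENTRY box (`…HomEntryTable.tabGB`) both lose the sign cancellation between classes: the true first-order variation of
`q_b(U) = ‖U f_b‖²` over an entry box of half-widths `w_ab` is `Σ_ab |P_a n_b| w_ab / SC²` with the EXACT integers `n_b = Σ_{j ≠ b} bⱼ`,
`P_a = Σ_c c_ac n_c` (`c` the entry centre) — `r/q ≈ 4–6·h` for every label instead of `16–25·h` for mixed-sign labels — and the energy gradient pulled
back to the entries is `G_ab = Σ_c c_ac H_cb`, `H_cb = Σ_{i ≠ c, j ≠ b} g_ij`, a LINEAR function of the six existing signed class gradients.  Float model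
(HOME/decomp-a2c-hand-1/g23/model): two dyadic width steps (×4) at 28/28 centres on the landed tier tables.  Semantics (companion modules):
hand-2's `…HomLeafPointsParam.leaf_sound_points_param` with `n = q = 9`, exact Jacobian, remainder `ρ`.

* §1 the RADIUS-GENERIC fold `stepR` / `foldNLR` (the landed `step1 … step4` verbatim, radius supplied as a function `r : NL → ℕ`), with proof-side
  predicates `farBR / rangeBR / stepOKR / treatedR / incrR` (radius-generic twins of `…HomLeafTableFold`);
* §2 the per-leaf ENTRY record `EP` (nine centre entries in `ℤ`, nine half-widths in `ℕ`), the label integers `n0 n1 n2`, `P0 P1 P2`, the entry radius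
  `r1 e l = ⌈Σ_a |P_a|·(Σ_b |n_b| w_ab) / SC⌉` and ★ `radP k e l = rad k l + r1 e l` (`k.wⱼ` now carries the REMAINDER classes `ρⱼ`);
* §3 the pulled-back penalty `penE` (once per leaf, `ℤ` arithmetic) and ★ `finalP`, ★★ `leafCheckP`;
* §4 from an ENTRY box `(c, w)`: off-sums `offS / offW`, the floored Gram centre `cG = ⌊Σ_a O_ia O_ja / 2SC⌋`, the remainder classes
  `rhoP = ⌊Σ_a W_ia W_ja / 2SC⌋ + 2`, the guard `cenOKP`, the derived Gram record `gbP` and entry record `epOf`.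

`--supports stmt-AtomisticToContinuum-27623`.
-/

namespace Summit.AtomisticToContinuum.Crystallization.Theorems.FrustratedLawDichotomyStrainedPatchHomLeafTableCheck

open Literature.Analysis.ValidatedNumerics.Numerics (SC)

/-! ## §1. The radius-generic fold -/

/-- The per-label step with the range radius supplied by `r` (`stepR tab k (rad k) = step tab k`). -/
def stepR (tab : QT) (k : LK) (r : NL → ℕ) (a : Acc) (l : NL) : Acc :=
  step1 tab a l (qPos k l) (qNeg k l) (r l)

/-- The fold with the range radius supplied by `r`, stopping at the first record with `n ≥ nstop`. -/
def foldNLR (tab : QT) (k : LK) (r : NL → ℕ) (nstop : ℕ) : Acc → List NL → Acc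
  | a, [] => a
  | a, l :: ls =>
    match Nat.ble nstop l.n with
    | true => a
    | false => foldNLR tab k r nstop (stepR tab k r a l) ls

/-- (proof side) The label is FAR for radius `r`: `81·SC ≤ 4·(q0 − r)`. -/
def farBR (k : LK) (r : NL → ℕ) (l : NL) : Bool := Nat.ble (Nat.mul 81 SCN) (Nat.mul 4 (q0N k l - r l))

/-- (proof side) The range test of `step3` for a row, radius `r`. -/
def rangeBR (k : LK) (r : NL → ℕ) (l : NL) (row : Row) : Bool :=
  Nat.ble row.A (q0N k l - r l) && Nat.ble (q0N k l + r l) row.B && Nat.ble row.t (q0N k l)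

/-- (proof side) The label passes the step without failure, radius `r`. -/
def stepOKR (tab : QT) (k : LK) (r : NL → ℕ) (l : NL) : Bool :=
  Nat.ble (qNeg k l + r l) (qPos k l) &&
    (farBR k r l || match rowOf tab k l with | none => false | some row => rangeBR k r l row)

/-- (proof side) The label is TREATED (not far, row found and in range), radius `r`. -/
def treatedR (tab : QT) (k : LK) (r : NL → ℕ) (l : NL) : Bool :=
  Nat.ble (qNeg k l + r l) (qPos k l) && !farBR k r l &&
    (match rowOf tab k l with | none => false | some row => rangeBR k r l row)

/-- (proof side) The label's increment, radius `r` (zero if not treated). -/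
def incrR (tab : QT) (k : LK) (r : NL → ℕ) (l : NL) : Acc :=
  match treatedR tab k r l, rowOf tab k l with
  | true, some row => step4 acc0 l (r l) row (q0N k l - row.t)
  | _, _ => acc0

/-! ## §2. Entry record, label integers, the entry radius -/

/-- Per-leaf ENTRY data: the nine centre entries `c_ab` (scale `SC`, signed) and the nine half-widths `w_ab` (scale `SC`). -/
structure EP where
  /-- centre entry `c₀₀` -/
  c00 : ℤ
  /-- centre entry `c₀₁` -/
  c01 : ℤ
  /-- centre entry `c₀₂` -/
  c02 : ℤ
  /-- centre entry `c₁₀` -/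
  c10 : ℤ
  /-- centre entry `c₁₁` -/
  c11 : ℤ
  /-- centre entry `c₁₂` -/
  c12 : ℤ
  /-- centre entry `c₂₀` -/
  c20 : ℤ
  /-- centre entry `c₂₁` -/
  c21 : ℤ
  /-- centre entry `c₂₂` -/
  c22 : ℤ
  /-- half-width `w₀₀` -/
  w00 : ℕ
  /-- half-width `w₀₁` -/
  w01 : ℕ
  /-- half-width `w₀₂` -/
  w02 : ℕ
  /-- half-width `w₁₀` -/
  w10 : ℕ
  /-- half-width `w₁₁` -/
  w11 : ℕ
  /-- half-width `w₁₂` -/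
  w12 : ℕ
  /-- half-width `w₂₀` -/
  w20 : ℕ
  /-- half-width `w₂₁` -/
  w21 : ℕ
  /-- half-width `w₂₂` -/
  w22 : ℕ

/-- `n₀ = b₁ + b₂` (the `0`-component of `√2·f_b`, `f_b = Σ bᵢ fccVec i`). -/
def n0 (l : NL) : ℤ := Int.add l.b1 l.b2

/-- `n₁ = b₀ + b₂`. -/
def n1 (l : NL) : ℤ := Int.add l.b0 l.b2

/-- `n₂ = b₀ + b₁`. -/
def n2 (l : NL) : ℤ := Int.add l.b0 l.b1

/-- `P₀ = Σ_c c₀c n_c` (row `0` of the centre applied to `n`; scale `SC`). -/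
def P0 (e : EP) (l : NL) : ℤ := Int.add (Int.add (Int.mul e.c00 (n0 l)) (Int.mul e.c01 (n1 l))) (Int.mul e.c02 (n2 l))

/-- `P₁ = Σ_c c₁c n_c`. -/
def P1 (e : EP) (l : NL) : ℤ := Int.add (Int.add (Int.mul e.c10 (n0 l)) (Int.mul e.c11 (n1 l))) (Int.mul e.c12 (n2 l))

/-- `P₂ = Σ_c c₂c n_c`. -/
def P2 (e : EP) (l : NL) : ℤ := Int.add (Int.add (Int.mul e.c20 (n0 l)) (Int.mul e.c21 (n1 l))) (Int.mul e.c22 (n2 l))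

/-- `NW₀ = Σ_b |n_b| w₀b` (scale `SC`). -/
def NW0 (e : EP) (l : NL) : ℕ :=
  Nat.add (Nat.add (Nat.mul (n0 l).natAbs e.w00) (Nat.mul (n1 l).natAbs e.w01)) (Nat.mul (n2 l).natAbs e.w02)

/-- `NW₁ = Σ_b |n_b| w₁b`. -/
def NW1 (e : EP) (l : NL) : ℕ :=
  Nat.add (Nat.add (Nat.mul (n0 l).natAbs e.w10) (Nat.mul (n1 l).natAbs e.w11)) (Nat.mul (n2 l).natAbs e.w12)

/-- `NW₂ = Σ_b |n_b| w₂b`. -/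
def NW2 (e : EP) (l : NL) : ℕ :=
  Nat.add (Nat.add (Nat.mul (n0 l).natAbs e.w20) (Nat.mul (n1 l).natAbs e.w21)) (Nat.mul (n2 l).natAbs e.w22)

/-- `Σ_a |P_a|·NW_a` (scale `SC²`): `SC²`× the first-order variation of `q_b` over the entry box. -/
def PNW (e : EP) (l : NL) : ℕ :=
  Nat.add (Nat.add (Nat.mul (P0 e l).natAbs (NW0 e l)) (Nat.mul (P1 e l).natAbs (NW1 e l))) (Nat.mul (P2 e l).natAbs (NW2 e l))

/-- ★ The ENTRY part of the label's range radius: `⌈Σ_a |P_a|·NW_a / SC⌉` (scale `SC`). -/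
def r1 (e : EP) (l : NL) : ℕ := Nat.div (Nat.add (PNW e l) (Nat.sub SCN 1)) SCN

/-- ★★ The PARAM-FORM range radius: remainder part `rad k l` (the classes `k.wⱼ` carry the remainders `ρⱼ`) + entry part `r1 e l`. -/
def radP (k : LK) (e : EP) (l : NL) : ℕ := Nat.add (rad k l) (r1 e l)

/-! ## §3. The pulled-back penalty and the verdict -/

/-- Signed class gradient `gP − gN` as an integer. -/
def gZ (P N : ℕ) : ℤ := Int.subNatNat P N

/-- `H₀₀ = g₁₁ + g₂₂ + 2g₁₂`. -/
def H00 (a : Acc) : ℤ := Int.add (Int.add (gZ a.g1P a.g1N) (gZ a.g2P a.g2N)) (Int.mul 2 (gZ a.g5P a.g5N))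

/-- `H₁₁ = g₀₀ + g₂₂ + 2g₀₂`. -/
def H11 (a : Acc) : ℤ := Int.add (Int.add (gZ a.g0P a.g0N) (gZ a.g2P a.g2N)) (Int.mul 2 (gZ a.g4P a.g4N))

/-- `H₂₂ = g₀₀ + g₁₁ + 2g₀₁`. -/
def H22 (a : Acc) : ℤ := Int.add (Int.add (gZ a.g0P a.g0N) (gZ a.g1P a.g1N)) (Int.mul 2 (gZ a.g3P a.g3N))

/-- `H₀₁ = H₁₀ = g₀₁ + g₀₂ + g₁₂ + g₂₂`. -/
def H01 (a : Acc) : ℤ := Int.add (Int.add (Int.add (gZ a.g3P a.g3N) (gZ a.g4P a.g4N)) (gZ a.g5P a.g5N)) (gZ a.g2P a.g2N)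

/-- `H₀₂ = H₂₀ = g₀₁ + g₀₂ + g₁₂ + g₁₁`. -/
def H02 (a : Acc) : ℤ := Int.add (Int.add (Int.add (gZ a.g3P a.g3N) (gZ a.g4P a.g4N)) (gZ a.g5P a.g5N)) (gZ a.g1P a.g1N)

/-- `H₁₂ = H₂₁ = g₀₀ + g₀₁ + g₀₂ + g₁₂`. -/
def H12 (a : Acc) : ℤ := Int.add (Int.add (Int.add (gZ a.g0P a.g0N) (gZ a.g3P a.g3N)) (gZ a.g4P a.g4N)) (gZ a.g5P a.g5N)

/-- `|x·H₀ + y·H₁ + z·H₂|` for a centre row `(x, y, z)` against a column `(H₀, H₁, H₂)` of `H`. -/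
def rowDot (x y z H0 H1 H2 : ℤ) : ℕ := (Int.add (Int.add (Int.mul x H0) (Int.mul y H1)) (Int.mul z H2)).natAbs

/-- `Σ_c |c_ac|·AN_cb` for a centre row against a column of the label constants `AN` (`E`-term coefficient). -/
def rowAbsDot (x y z : ℤ) (N0 N1 N2 : ℕ) : ℕ := Nat.add (Nat.add (Nat.mul x.natAbs N0) (Nat.mul y.natAbs N1)) (Nat.mul z.natAbs N2)

/-- One entry term `(|G_ab| + E·AE_ab)·w_ab` of the penalty. -/
def penTerm (E G AE w : ℕ) : ℕ := Nat.mul (Nat.add G (Nat.mul E AE)) w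

/-- ★ The ENTRY penalty `Σ_ab (|Σ_c c_ac H_cb| + E·Σ_c |c_ac| AN_cb)·w_ab` (scale `SC³`; `AN_cb = Σ_labels |n_c n_b|`: `ANd` diagonal, `ANo` off-diagonal). -/
def penE (E ANd ANo : ℕ) (e : EP) (a : Acc) : ℕ :=
  Nat.add (Nat.add
    (Nat.add (Nat.add
      (penTerm E (rowDot e.c00 e.c01 e.c02 (H00 a) (H01 a) (H02 a)) (rowAbsDot e.c00 e.c01 e.c02 ANd ANo ANo) e.w00)
      (penTerm E (rowDot e.c00 e.c01 e.c02 (H01 a) (H11 a) (H12 a)) (rowAbsDot e.c00 e.c01 e.c02 ANo ANd ANo) e.w01))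
      (penTerm E (rowDot e.c00 e.c01 e.c02 (H02 a) (H12 a) (H22 a)) (rowAbsDot e.c00 e.c01 e.c02 ANo ANo ANd) e.w02))
    (Nat.add (Nat.add
      (penTerm E (rowDot e.c10 e.c11 e.c12 (H00 a) (H01 a) (H02 a)) (rowAbsDot e.c10 e.c11 e.c12 ANd ANo ANo) e.w10)
      (penTerm E (rowDot e.c10 e.c11 e.c12 (H01 a) (H11 a) (H12 a)) (rowAbsDot e.c10 e.c11 e.c12 ANo ANd ANo) e.w11))
      (penTerm E (rowDot e.c10 e.c11 e.c12 (H02 a) (H12 a) (H22 a)) (rowAbsDot e.c10 e.c11 e.c12 ANo ANo ANd) e.w12)))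
    (Nat.add (Nat.add
      (penTerm E (rowDot e.c20 e.c21 e.c22 (H00 a) (H01 a) (H02 a)) (rowAbsDot e.c20 e.c21 e.c22 ANd ANo ANo) e.w20)
      (penTerm E (rowDot e.c20 e.c21 e.c22 (H01 a) (H11 a) (H12 a)) (rowAbsDot e.c20 e.c21 e.c22 ANo ANd ANo) e.w21))
      (penTerm E (rowDot e.c20 e.c21 e.c22 (H02 a) (H12 a) (H22 a)) (rowAbsDot e.c20 e.c21 e.c22 ANo ANo ANd) e.w22))

/-- Left side of the final inequality: the landed `lhs` (value / centre-correction / `E` / REMAINDER-class penalty `gradPen`, curvature) plus `2·penE`. -/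
def lhsP (E A0 A1 A2 A3 A4 A5 ANd ANo : ℕ) (k : LK) (e : EP) (μP : ℕ) (a : Acc) : ℕ :=
  Nat.add (lhs E μP (gradPen E A0 A1 A2 A3 A4 A5 k a) a) (Nat.mul 2 (penE E ANd ANo e a))

/-- ★ The final verdict of the param-form leaf. -/
def finalP (E A0 A1 A2 A3 A4 A5 ANd ANo : ℕ) (k : LK) (e : EP) (sμ : Bool) (aμ : ℕ) (a : Acc) : Bool :=
  a.ok && Nat.ble (lhsP E A0 A1 A2 A3 A4 A5 ANd ANo k e (addP sμ aμ 0) a) (rhs (addN sμ aμ 0) a)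

/-- ★★ **THE PARAM-FORM LEAF CHECK**: table `tab`, near-label list `labs`, derivative half-width `E`, class sums `Aⱼ`, the two `n`-class sums `ANd`
(`Σ |n_c n_c|`) and `ANo` (`Σ |n_c n_b|`, `c ≠ b`), stop norm, the Gram-centre/remainder record `k` (`k.cⱼ` = floored Gram centre classes, `k.wⱼ` =
remainder classes `ρⱼ`), the entry record `e`, the target `∓aμ`. -/
def leafCheckP (tab : QT) (labs : List NL) (E A0 A1 A2 A3 A4 A5 ANd ANo nstop : ℕ) (k : LK) (e : EP) (sμ : Bool) (aμ : ℕ) : Bool :=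
  finalP E A0 A1 A2 A3 A4 A5 ANd ANo k e sμ aμ (foldNLR tab k (radP k e) nstop acc0 labs)

/-! ## §4. From an entry box -/

/-- Off-sum of centre row `a` off column `i`: `O_ia = Σ_{b ≠ i} c_ab` (= `SC·√2·(U₀ fccVec i)_a`). -/
def offS (c : Fin 3 × Fin 3 → ℤ) (i a : Fin 3) : ℤ :=
  if i = 0 then c (a, 1) + c (a, 2) else if i = 1 then c (a, 0) + c (a, 2) else c (a, 0) + c (a, 1)

/-- Off-sum of half-widths of row `a` off column `i`: `W_ia = Σ_{b ≠ i} w_ab`. -/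
def offW (w : Fin 3 × Fin 3 → ℤ) (i a : Fin 3) : ℕ :=
  if i = 0 then (w (a, 1)).toNat + (w (a, 2)).toNat else if i = 1 then (w (a, 0)).toNat + (w (a, 2)).toNat
    else (w (a, 0)).toNat + (w (a, 1)).toNat

/-- The FLOORED Gram centre `cG_ij = ⌊Σ_a O_ia O_ja / (2·SC)⌋` (scale `SC`; within `1/SC` below `⟪U₀ fᵢ, U₀ fⱼ⟫`). -/
def cG (c : Fin 3 × Fin 3 → ℤ) (i j : Fin 3) : ℤ :=
  (offS c i 0 * offS c j 0 + offS c i 1 * offS c j 1 + offS c i 2 * offS c j 2) / (2 * (SC : ℤ))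

/-- The REMAINDER bound `ρ_ij = ⌊Σ_a W_ia W_ja / (2·SC)⌋ + 2` (scale `SC`): second-order term `½ Σ_a Δ_ia Δ_ja` plus the two roundings. -/
def rhoP (w : Fin 3 × Fin 3 → ℤ) (i j : Fin 3) : ℕ :=
  (offW w i 0 * offW w j 0 + offW w i 1 * offW w j 1 + offW w i 2 * offW w j 2) / (2 * SCN) + 2

/-- Guard: every floored Gram centre is `≥ 0` (so that it can be stored in the `ℕ` record). -/
def cenOKP (c : Fin 3 × Fin 3 → ℤ) : Bool :=
  decide (0 ≤ cG c 0 0) && decide (0 ≤ cG c 0 1) && decide (0 ≤ cG c 0 2) && decide (0 ≤ cG c 1 0) && decide (0 ≤ cG c 1 1) &&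
    decide (0 ≤ cG c 1 2) && decide (0 ≤ cG c 2 0) && decide (0 ≤ cG c 2 1) && decide (0 ≤ cG c 2 2)

/-- ★ The derived Gram record of an entry box: centres `cG`, "half-widths" = remainders `rhoP` (fed to `rad` / `gradPen` through `GB.toLK`). -/
def gbP (c w : Fin 3 × Fin 3 → ℤ) : GB :=
  ⟨(cG c 0 0).toNat, (cG c 0 1).toNat, (cG c 0 2).toNat, (cG c 1 0).toNat, (cG c 1 1).toNat, (cG c 1 2).toNat,
   (cG c 2 0).toNat, (cG c 2 1).toNat, (cG c 2 2).toNat,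
   rhoP w 0 0, rhoP w 0 1, rhoP w 0 2, rhoP w 1 0, rhoP w 1 1, rhoP w 1 2, rhoP w 2 0, rhoP w 2 1, rhoP w 2 2⟩

/-- ★ The entry record of an entry box. -/
def epOf (c w : Fin 3 × Fin 3 → ℤ) : EP :=
  ⟨c (0, 0), c (0, 1), c (0, 2), c (1, 0), c (1, 1), c (1, 2), c (2, 0), c (2, 1), c (2, 2),
   (w (0, 0)).toNat, (w (0, 1)).toNat, (w (0, 2)).toNat, (w (1, 0)).toNat, (w (1, 1)).toNat, (w (1, 2)).toNat,
   (w (2, 0)).toNat, (w (2, 1)).toNat, (w (2, 2)).toNat⟩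

/-- The `n`-class sums of the tree's near-label list `nearLabels`: `Σ |n_c|² = 8900` (each `c`). -/
def tabANd : ℕ := 8900

/-- … and `Σ |n_c n_b| = 5678` (each `c ≠ b`). -/
def tabANo : ℕ := 5678

end Summit.AtomisticToContinuum.Crystallization.Theorems.FrustratedLawDichotomyStrainedPatchHomLeafTableCheck
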